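import Summits.QuantumFields.YangMills.Theorems.PoincareLipschitzStretchedOfMoments
import Summits.QuantumFields.YangMills.Theorems.PoincareLipschitzOrbitMinHolderRegularityOfImprove

/-!
# Crux `HistoryTailL` (stmt-QuantumFields-19936), line #12 — THE ψ_α GLUE (S5): THE K2 DISPLAY v2 ON THE K1 SHAPE AXIS —
# `HistoryTailL ⟸ {K1-ψ_α | K1-moments(α)} ∧ hImprove ∧ MeanDeviationL`, for every `α > 0`

Cell `ym3-torus` (YM ladder rung R3 = continuum SU(2) Yang–Mills on the 3-torus — NOT d = 4, NOT infinite volume, NOT a mass gap, NOT the Clay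
problem), width seat `ym-ust-19936-w4` gen 13; `--supports stmt-QuantumFields-19936 --as helper`.  By LEAD ★w1-19936 g9's final knit K-3
✓`PoincareLipschitzOrbitMinHolderRegularityOfImprove.blockLipschitzL_of_hImprove` the route crux `BlockLipschitzL` (K2) is a theorem MODULO the one
displayed classical organ `hImprove` (v1 899858e5: energy improvement at bounded normalised energy for twisted lattice minimisers into `S³`), so the
K2 display of record v2 reads `HistoryTailL ⟸ {K1-exp, hImprove, MeanDeviationL}` (✓p700135 ∘ K-3).  THIS FILE writes the same display with the K1
binder in its two weakest typed SHAPES (S3 ✓`historyTailL_of_stretchedConcentration`, S4 ✓`historyTailL_of_momentGrowth`): for every `α > 0`,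

* ★★★`historyTailL_of_stretchedConcentration_of_hImprove (α) (hα) (hC : K1-ψ_α) (hI : hImprove) (hM : MeanDeviationL) : UnitScaleTilt.HistoryTailL`,
* ★★★`historyTailL_of_momentGrowth_of_hImprove (α) (hα) (hMom : K1-moments(α)) (hI : hImprove) (hM : MeanDeviationL) : UnitScaleTilt.HistoryTailL`,

both by `exact` (pure composition; the `hImprove` text is K-3's binder VERBATIM).  HONEST: corollaries only; `hImprove` (the K2 residue of record,
decomposed by RULING g9-6 into `hImproveCore ∧ hLogFreeDecay`), K1 (in any shape), `MeanDeviationL` are OPEN; nothing of the cruxes, rung R3 or the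
mass gap is proved.  THEOREMS ONLY, definition-free.
[cite: Balaban1985UV3, (7) p.257 and (71) p.273; Balaban1987RG1, (0.14) p.254]
-/

set_option autoImplicit false

noncomputable section

namespace Summit.QuantumFields.YangMills.Theorems.PoincareLipschitzStretched

open MeasureTheory
open scoped BigOperators
open Literature.MathematicalPhysics.QuantumFieldTheory.Balaban1983to89
open Literature.MathematicalPhysics.QuantumFieldTheory.Balaban1983to89.T3ContinuumYM3Torus
open Literature.MathematicalPhysics.QuantumFieldTheory.Balaban1983to89.T3UnitScaleTilt
open Literature.MathematicalPhysics.QuantumFieldTheory.Balaban1983to89.T3UnitLawDensityEML (ℰp)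
open B4Eq19LatticeOperators (Zd box unitVec)
open Summit.QuantumFields.YangMills.Theorems.PoincareLipschitzOrbitMinHolderRegularityOfImprove (blockLipschitzL_of_hImprove)

/-- ★★★ **K2 DISPLAY v2 × K1 SHAPE AXIS (ψ_α)**: `UnitScaleTilt.HistoryTailL ⟸ K1-ψ_α ∧ hImprove ∧ MeanDeviationL` for every `α > 0` — the LEAD's
display of record v2 with the concentration binder of ANY stretched-exponential shape at the Hodge–Poincaré scale (S3) and the K2 crux discharged
modulo the organ `hImprove` by K-3 ✓`blockLipschitzL_of_hImprove`.  Pure composition. [cite: Balaban1985UV3, (7) p.257 and (71) p.273] -/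
theorem historyTailL_of_stretchedConcentration_of_hImprove (α : ℝ) (hα : 0 < α)
    (hC : ∀ (L : ℕ), ∃ (Cc cc : ℝ), 0 ≤ Cc ∧ 0 < cc ∧ ∃ γ₁ : ℝ, 0 < γ₁ ∧ γ₁ ≤ 1 ∧
      ∀ (F : T3Family) (γ : ℝ), F.L = L → 0 < γ → γ ≤ γ₁ → ∀ (K n : ℕ), 1 ≤ n →
        (n : ℝ) ≤ (F.scheme ℰp γ).β K → 2 * n ≤ (F.P K).sitesPerDir 0 →
        ∀ (x₀ : Site (F.P K) 0) (f : GaugeField (F.P K) 0 (Matrix.specialUnitaryGroup (Fin 2) ℂ) → ℝ) (Λ : ℝ), 0 < Λ →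
          Measurable f → GaugeField.GaugeInvariant f →
          (∀ U U' : GaugeField (F.P K) 0 (Matrix.specialUnitaryGroup (Fin 2) ℂ),
            (∀ b : PBond (F.P K) 0, (∀ k, (b.src k - x₀ k).val < n) → (∀ k, (b.tgt k - x₀ k).val < n) → U b = U' b) →
              f U = f U') →
          (∀ U U' : GaugeField (F.P K) 0 (Matrix.specialUnitaryGroup (Fin 2) ℂ),
            |f U - f U'| ≤ Λ * Real.sqrt (∑ b : PBond (F.P K) 0, GaugeGroup.dist1 (U b * (U' b)⁻¹) ^ 2)) →
          ∀ r : ℝ, 0 ≤ r →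
            (gibbsK F ℰp γ K).real {U | r ≤ f U - ∫ V, f V ∂(gibbsK F ℰp γ K)} ≤
              Cc * Real.exp (-(cc * (Real.sqrt ((F.scheme ℰp γ).β K) * r / ((n : ℝ) * Λ)) ^ α)))
    (hI : ∀ (Λ₀ ε₀ κ : ℝ), 0 < Λ₀ → 0 < ε₀ → 1 ≤ κ →
      ∃ (C₀ R₀ : ℝ), 1 ≤ C₀ ∧ 1 ≤ R₀ ∧
      ∀ (u : Zd 3 → EuclideanSpace ℝ (Fin 4)) (τ : Fin 3 → Zd 3 → (EuclideanSpace ℝ (Fin 4) ≃ₗᵢ[ℝ] EuclideanSpace ℝ (Fin 4)))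
      (z : Zd 3) (R : ℤ) (τ₀ : ℝ),
      R₀ ≤ R →
      (∀ y, ‖u y‖ = 1) →
      (∀ y ∈ box z (R + 1), ∀ (μ : Fin 3) (w : EuclideanSpace ℝ (Fin 4)), ‖τ μ y w - w‖ ≤ τ₀ * ‖w‖) →
      τ₀ * (R : ℝ) ≤ C₀⁻¹ →
      (∀ y ∈ box z R,
      ‖∑ μ : Fin 3, (τ μ y (u (y + unitVec μ)) + (τ μ (y - unitVec μ)).symm (u (y - unitVec μ)))‖ • u y =
      ∑ μ : Fin 3, (τ μ y (u (y + unitVec μ)) + (τ μ (y - unitVec μ)).symm (u (y - unitVec μ)))) →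
      (∀ (z' : Zd 3) (R' : ℤ), 0 ≤ R' → box z' (R' + 1) ⊆ box z R →
      ∀ v : Zd 3 → EuclideanSpace ℝ (Fin 4), (∀ y, y ∉ box z' R' → v y = u y) → (∀ y ∈ box z' R', ‖v y‖ = 1) →
      ∑ y ∈ box z' (R' + 1), ∑ μ : Fin 3, ‖τ μ y (u (y + unitVec μ)) - u y‖ ^ 2 ≤
      ∑ y ∈ box z' (R' + 1), ∑ μ : Fin 3, ‖τ μ y (v (y + unitVec μ)) - v y‖ ^ 2) →
      (∑ y ∈ box z R, ∑ μ : Fin 3, ‖τ μ y (u (y + unitVec μ)) - u y‖ ^ 2 ≤ Λ₀ * R) →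
      ∃ r : ℤ, 1 ≤ r ∧ (R : ℝ) ≤ C₀ * Real.log R ^ 6 * r ∧ κ * Real.log R ^ 6 * r ≤ R ∧
      box z (2 * r) ⊆ box z R ∧
      (∑ y ∈ box z (2 * r), ∑ μ : Fin 3, ‖τ μ y (u (y + unitVec μ)) - u y‖ ^ 2) * Real.log r ^ 6 ≤ ε₀ * r)
    (hM : Summit.QuantumFields.YangMills.Theses.PoincareLipschitz.MeanDeviationL) :
    Summit.QuantumFields.YangMills.Theses.UnitScaleTilt.HistoryTailL :=
  historyTailL_of_stretchedConcentration α hα hC (blockLipschitzL_of_hImprove hI) hM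

/-- ★★★ **K2 DISPLAY v2 × K1 SHAPE AXIS (moments)**: `UnitScaleTilt.HistoryTailL ⟸ K1-moments(α) ∧ hImprove ∧ MeanDeviationL` for every `α > 0` —
centred-moment growth `‖f − ∫f‖_q ≤ CM·(n·Λ∕√β_K)·q^{1∕α}` (integer `q ≥ 1`) of box-local gauge-invariant Lipschitz observables (S4
✓`historyTailL_of_momentGrowth`) and the organ `hImprove` (K-3 ✓`blockLipschitzL_of_hImprove`).  Pure composition.
[cite: Balaban1985UV3, (7) p.257 and (71) p.273] -/
theorem historyTailL_of_momentGrowth_of_hImprove (α : ℝ) (hα : 0 < α)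
    (hMom : ∀ (L : ℕ), ∃ (CM : ℝ), 0 < CM ∧ ∃ γ₁ : ℝ, 0 < γ₁ ∧ γ₁ ≤ 1 ∧
      ∀ (F : T3Family) (γ : ℝ), F.L = L → 0 < γ → γ ≤ γ₁ → ∀ (K n : ℕ), 1 ≤ n →
        (n : ℝ) ≤ (F.scheme ℰp γ).β K → 2 * n ≤ (F.P K).sitesPerDir 0 →
        ∀ (x₀ : Site (F.P K) 0) (f : GaugeField (F.P K) 0 (Matrix.specialUnitaryGroup (Fin 2) ℂ) → ℝ) (Λ : ℝ), 0 < Λ →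
          Measurable f → GaugeField.GaugeInvariant f →
          (∀ U U' : GaugeField (F.P K) 0 (Matrix.specialUnitaryGroup (Fin 2) ℂ),
            (∀ b : PBond (F.P K) 0, (∀ k, (b.src k - x₀ k).val < n) → (∀ k, (b.tgt k - x₀ k).val < n) → U b = U' b) →
              f U = f U') →
          (∀ U U' : GaugeField (F.P K) 0 (Matrix.specialUnitaryGroup (Fin 2) ℂ),
            |f U - f U'| ≤ Λ * Real.sqrt (∑ b : PBond (F.P K) 0, GaugeGroup.dist1 (U b * (U' b)⁻¹) ^ 2)) →
          ∀ q : ℕ, 1 ≤ q →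
            ∫ U, |f U - ∫ V, f V ∂(gibbsK F ℰp γ K)| ^ q ∂(gibbsK F ℰp γ K) ≤
              (CM * ((n : ℝ) * Λ / Real.sqrt ((F.scheme ℰp γ).β K)) * (q : ℝ) ^ (1 / α)) ^ q)
    (hI : ∀ (Λ₀ ε₀ κ : ℝ), 0 < Λ₀ → 0 < ε₀ → 1 ≤ κ →
      ∃ (C₀ R₀ : ℝ), 1 ≤ C₀ ∧ 1 ≤ R₀ ∧
      ∀ (u : Zd 3 → EuclideanSpace ℝ (Fin 4)) (τ : Fin 3 → Zd 3 → (EuclideanSpace ℝ (Fin 4) ≃ₗᵢ[ℝ] EuclideanSpace ℝ (Fin 4)))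
      (z : Zd 3) (R : ℤ) (τ₀ : ℝ),
      R₀ ≤ R →
      (∀ y, ‖u y‖ = 1) →
      (∀ y ∈ box z (R + 1), ∀ (μ : Fin 3) (w : EuclideanSpace ℝ (Fin 4)), ‖τ μ y w - w‖ ≤ τ₀ * ‖w‖) →
      τ₀ * (R : ℝ) ≤ C₀⁻¹ →
      (∀ y ∈ box z R,
      ‖∑ μ : Fin 3, (τ μ y (u (y + unitVec μ)) + (τ μ (y - unitVec μ)).symm (u (y - unitVec μ)))‖ • u y =
      ∑ μ : Fin 3, (τ μ y (u (y + unitVec μ)) + (τ μ (y - unitVec μ)).symm (u (y - unitVec μ)))) →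
      (∀ (z' : Zd 3) (R' : ℤ), 0 ≤ R' → box z' (R' + 1) ⊆ box z R →
      ∀ v : Zd 3 → EuclideanSpace ℝ (Fin 4), (∀ y, y ∉ box z' R' → v y = u y) → (∀ y ∈ box z' R', ‖v y‖ = 1) →
      ∑ y ∈ box z' (R' + 1), ∑ μ : Fin 3, ‖τ μ y (u (y + unitVec μ)) - u y‖ ^ 2 ≤
      ∑ y ∈ box z' (R' + 1), ∑ μ : Fin 3, ‖τ μ y (v (y + unitVec μ)) - v y‖ ^ 2) →
      (∑ y ∈ box z R, ∑ μ : Fin 3, ‖τ μ y (u (y + unitVec μ)) - u y‖ ^ 2 ≤ Λ₀ * R) →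
      ∃ r : ℤ, 1 ≤ r ∧ (R : ℝ) ≤ C₀ * Real.log R ^ 6 * r ∧ κ * Real.log R ^ 6 * r ≤ R ∧
      box z (2 * r) ⊆ box z R ∧
      (∑ y ∈ box z (2 * r), ∑ μ : Fin 3, ‖τ μ y (u (y + unitVec μ)) - u y‖ ^ 2) * Real.log r ^ 6 ≤ ε₀ * r)
    (hM : Summit.QuantumFields.YangMills.Theses.PoincareLipschitz.MeanDeviationL) :
    Summit.QuantumFields.YangMills.Theses.UnitScaleTilt.HistoryTailL :=
  historyTailL_of_momentGrowth α hα hMom (blockLipschitzL_of_hImprove hI) hM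

end Summit.QuantumFields.YangMills.Theorems.PoincareLipschitzStretched

end
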